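import Mathlib
import HarnessLib
import Literature.Probability.LatticeModels.GibbsSpecificationProofs
import Literature.Probability.LatticeModels.CriticalGibbsUniqueness
import Literature.Probability.LatticeModels.IsingConfigSums

/-!
# Punctured DLR measures: the boundary-condition sandwich on `{σ_z = s}`
(route BallSpecification, support item stmt-CriticalPhenomena-5730 `LatticePuncturedUniqueness`,
helper file 2/3)

For the Ising model on a locally finite graph `G` (countable vertex set) at `β ≥ 0`:

* `measureReal_forall_eq_one_sub_le_sum` — the finite-volume gap bound of Friedli–Velenik 2017,
  proof of Thm. 3.28, for two ordered boundary conditions `η₁ ≤ η₂`: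
  `μ^{η₂}_Λ(σ_B ≡ +1) − μ^{η₁}_Λ(σ_B ≡ +1) ≤ ∑_{i ∈ B} (μ^{η₂}_Λ(σ_i = 1) − μ^{η₁}_Λ(σ_i = 1))`;
* `sandwich_of_punctured_dlr` — if a probability measure `ρ` satisfies the DLR equation for a
  volume `Λ` not containing the site `z`, then on the cylinder `{σ_z = s}` the increasing events
  `E_B = {σ_B ≡ +1}` are sandwiched between the kernels with the extreme boundary conditions
  compatible with `σ_z = s`:
  `μ^{−[z↦s]}_Λ(E_B) ρ(σ_z = s) ≤ ρ(E_B ∩ {σ_z = s}) ≤ μ^{+[z↦s]}_Λ(E_B) ρ(σ_z = s)`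
  (DLR + properness + monotonicity in the boundary condition, Friedli–Velenik 2017, Lemma 3.23 /
  Exercise 3.13 and Lemma 6.65, eq. (6.70));
* `abs_sub_le_of_punctured_dlr` — hence two such measures giving the same mass to `{σ_z = s}`
  differ on `E_B ∩ {σ_z = s}` by at most the punctured gap `∑_{i∈B} (μ^{+[z↦s]}_Λ − μ^{−[z↦s]}_Λ)(σ_i = 1)`.

References: S. Friedli, Y. Velenik, *Statistical Mechanics of Lattice Systems* (CUP 2017),
Exercise 3.10, Lemma 3.23, Thm. 3.28, Lemma 6.65; H.-O. Georgii, *Gibbs Measures and Phase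
Transitions* (2011), Def. 1.23. No definitions, no named facts.
-/

namespace Summit.CriticalPhenomena.Ising3DConformalLimit.Theorems.LatticePunctured

open MeasureTheory Filter Topology Finset
open scoped ENNReal
open Literature.Probability.LatticeModels

variable {V : Type*} (G : SimpleGraph V) [DecidableEq V] [G.LocallyFinite]

/-- **Gap bound for ordered boundary conditions** (Friedli–Velenik 2017, proof of Thm. 3.28,
p. 117, with Lemma 3.23 / Exercise 3.13): for `β ≥ 0` and `η₁ ≤ η₂`,
`μ^{η₂}_Λ(σ_B ≡ +1) − μ^{η₁}_Λ(σ_B ≡ +1) ≤ ∑_{i ∈ B} (μ^{η₂}_Λ(σ_i = 1) − μ^{η₁}_Λ(σ_i = 1))`, because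
`∑_{i∈B} n_i − n_B` is nondecreasing. [cite: FriedliVelenik2017, Thm. 3.28, p. 117] -/
theorem measureReal_forall_eq_one_sub_le_sum {β : ℝ} (hβ : 0 ≤ β) (Λ : Finset V) (h : ℝ)
    {η₁ η₂ : SpinConfig V} (hη : η₁ ≤ η₂) (B : Finset V) :
    (isingMeasure G Λ β h (.fixed η₂)).real {σ : SpinConfig V | ∀ i ∈ B, σ i = 1} -
        (isingMeasure G Λ β h (.fixed η₁)).real {σ : SpinConfig V | ∀ i ∈ B, σ i = 1} ≤
      ∑ i ∈ B, ((isingMeasure G Λ β h (.fixed η₂)).real {σ : SpinConfig V | σ i = 1} -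
        (isingMeasure G Λ β h (.fixed η₁)).real {σ : SpinConfig V | σ i = 1}) := by
  have hmeas : Measurable fun σ : SpinConfig V =>
      (∑ i ∈ B, ({σ : SpinConfig V | σ i = 1}).indicator (1 : SpinConfig V → ℝ) σ) -
        ({σ : SpinConfig V | ∀ i ∈ B, σ i = 1}).indicator (1 : SpinConfig V → ℝ) σ :=
    (Finset.measurable_sum B fun i _ => measurable_one.indicator (measurableSet_eq_one i)).sub
      (measurable_one.indicator (measurableSet_forall_eq_one B))
  have key := integral_isingMeasure_fixed_mono G hβ Λ h hη
    (monotone_sum_indicator_sub_indicator B) hmeas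
  rw [integral_sum_indicator_sub_indicator, integral_sum_indicator_sub_indicator] at key
  rw [Finset.sum_sub_distrib]
  linarith

/-- On `{σ_z = s}` every configuration lies between the extreme configurations with the spin `s`
at `z`: `(-1)[z ↦ s] ≤ η`. [folklore] -/
theorem update_neg_one_le {z : V} {s : ℤˣ} {η : SpinConfig V} (hη : η z = s) :
    Function.update (-1 : SpinConfig V) z s ≤ η := by
  intro x
  by_cases hx : x = z
  · subst hx
    rw [Function.update_self, hη]
  · rw [Function.update_of_ne hx]
    exact neg_one_le_intUnits (η x)

/-- On `{σ_z = s}`: `η ≤ 1[z ↦ s]`. [folklore] -/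
theorem le_update_one {z : V} {s : ℤˣ} {η : SpinConfig V} (hη : η z = s) :
    η ≤ Function.update (1 : SpinConfig V) z s := by
  intro x
  by_cases hx : x = z
  · subst hx
    rw [Function.update_self, hη]
  · rw [Function.update_of_ne hx]
    exact intUnits_le_one (η x)

/-- **A frozen site: properness on a cylinder** (Georgii 2011, Def. 1.23 (ii)): for `z ∉ Λ`,
`μ^η_Λ(A ∩ {σ_z = s}) = 1{η_z = s} · μ^η_Λ(A)` as an indicator in `η`. [cite: Georgii2011, Def. 1.23] -/
theorem isingMeasure_fixed_inter_apply_eq_indicator [Countable V] (Λ : Finset V) {z : V}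
    (hz : z ∉ Λ) (β h : ℝ) (s : ℤˣ) (A : Set (SpinConfig V)) (η : SpinConfig V) :
    isingMeasure G Λ β h (.fixed η) (A ∩ {σ : SpinConfig V | σ z = s}) =
      ({η : SpinConfig V | η z = s}).indicator
        (fun η => isingMeasure G Λ β h (.fixed η) A) η := by
  have hae := ae_eqOn_compl_isingMeasure_fixed G Λ β h η
  by_cases hη : η z = s
  · rw [Set.indicator_of_mem (show η ∈ {η : SpinConfig V | η z = s} from hη)]
    refine measure_inter_conull (mem_ae_iff.1 ?_)
    filter_upwards [hae] with σ hσ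
    exact (hσ z hz).trans hη
  · rw [Set.indicator_of_notMem (show η ∉ {η : SpinConfig V | η z = s} from hη)]
    refine measure_inter_null_of_null_right A (measure_eq_zero_iff_ae_notMem.2 ?_)
    filter_upwards [hae] with σ hσ
    show ¬ (σ z = s)
    rw [hσ z hz]
    exact hη

/-- **The boundary-condition sandwich on `{σ_z = s}` for a punctured-DLR measure**
(Friedli–Velenik 2017, Lemma 6.65, eq. (6.70), with Lemma 3.23 / Exercise 3.13): let `β ≥ 0`,
`z ∉ Λ`, and let the probability measure `ρ` satisfy the DLR equation `ρ = ρ γ_Λ` for the Ising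
kernel of `Λ`. Then for every finite `B`,
`μ^{(-1)[z↦s]}_Λ(σ_B ≡ +1) · ρ(σ_z = s) ≤ ρ({σ_B ≡ +1} ∩ {σ_z = s}) ≤ μ^{1[z↦s]}_Λ(σ_B ≡ +1) · ρ(σ_z = s)`:
by DLR and properness `ρ(E ∩ {σ_z = s}) = ∫_{η_z = s} μ^η_Λ(E) dρ`, and on `{η_z = s}` the boundary
condition is squeezed between `(-1)[z↦s]` and `1[z↦s]`. [cite: FriedliVelenik2017, Lemma 6.65, eq. (6.70), p. 311] -/
theorem sandwich_of_punctured_dlr [Countable V] {β : ℝ} (hβ : 0 ≤ β) (h : ℝ) {Λ : Finset V}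
    {z : V} (hz : z ∉ Λ) {ρ : Measure (SpinConfig V)} [IsProbabilityMeasure ρ]
    (hDLR : ∀ A : Set (SpinConfig V), MeasurableSet A →
      ∫⁻ η, isingMeasure G Λ β h (.fixed η) A ∂ρ = ρ A)
    (s : ℤˣ) (B : Finset V) :
    (isingMeasure G Λ β h (.fixed (Function.update (-1) z s))).real
          {σ : SpinConfig V | ∀ i ∈ B, σ i = 1} * ρ.real {σ : SpinConfig V | σ z = s} ≤
        ρ.real ({σ : SpinConfig V | ∀ i ∈ B, σ i = 1} ∩ {σ : SpinConfig V | σ z = s}) ∧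
      ρ.real ({σ : SpinConfig V | ∀ i ∈ B, σ i = 1} ∩ {σ : SpinConfig V | σ z = s}) ≤
        (isingMeasure G Λ β h (.fixed (Function.update 1 z s))).real
          {σ : SpinConfig V | ∀ i ∈ B, σ i = 1} * ρ.real {σ : SpinConfig V | σ z = s} := by
  set E : Set (SpinConfig V) := {σ : SpinConfig V | ∀ i ∈ B, σ i = 1} with hE
  set S : Set (SpinConfig V) := {σ : SpinConfig V | σ z = s} with hS
  have hEm : MeasurableSet E := measurableSet_forall_eq_one B
  have hSm : MeasurableSet S := measurableSet_apply_eq z s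
  -- DLR + properness: `ρ(E ∩ S) = ∫_{S} μ^η_Λ(E) dρ`
  have hrepr : ρ (E ∩ S) = ∫⁻ η in S, isingMeasure G Λ β h (.fixed η) E ∂ρ := by
    rw [← hDLR (E ∩ S) (hEm.inter hSm), ← lintegral_indicator hSm]
    refine lintegral_congr fun η => ?_
    exact isingMeasure_fixed_inter_apply_eq_indicator G Λ hz β h s E η
  -- pointwise bounds on `S`
  have hlow : ∀ η ∈ S, ENNReal.ofReal ((isingMeasure G Λ β h
      (.fixed (Function.update (-1) z s))).real E) ≤ isingMeasure G Λ β h (.fixed η) E := by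
    intro η hη
    rw [← ofReal_measureReal (measure_ne_top _ E)]
    refine ENNReal.ofReal_le_ofReal ?_
    rw [← integral_indicator_one hEm, ← integral_indicator_one hEm]
    exact integral_isingMeasure_fixed_mono G hβ Λ h (update_neg_one_le hη)
      (monotone_indicator_forall_eq_one B) (measurable_one.indicator hEm)
  have hupp : ∀ η ∈ S, isingMeasure G Λ β h (.fixed η) E ≤ ENNReal.ofReal ((isingMeasure G Λ β h
      (.fixed (Function.update 1 z s))).real E) := by
    intro η hη
    rw [← ofReal_measureReal (measure_ne_top _ E)]
    refine ENNReal.ofReal_le_ofReal ?_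
    rw [← integral_indicator_one hEm, ← integral_indicator_one hEm]
    exact integral_isingMeasure_fixed_mono G hβ Λ h (le_update_one hη)
      (monotone_indicator_forall_eq_one B) (measurable_one.indicator hEm)
  have h1 : ENNReal.ofReal ((isingMeasure G Λ β h (.fixed (Function.update (-1) z s))).real E) *
      ρ S ≤ ρ (E ∩ S) := by
    rw [hrepr, ← setLIntegral_const]
    exact setLIntegral_mono' hSm hlow
  have h2 : ρ (E ∩ S) ≤ ENNReal.ofReal ((isingMeasure G Λ β h
      (.fixed (Function.update 1 z s))).real E) * ρ S := by
    rw [hrepr, ← setLIntegral_const]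
    exact setLIntegral_mono' hSm hupp
  constructor
  · have := (ENNReal.toReal_le_toReal (by finiteness) (measure_ne_top ρ _)).2 h1
    rwa [ENNReal.toReal_mul, ENNReal.toReal_ofReal measureReal_nonneg] at this
  · have := (ENNReal.toReal_le_toReal (measure_ne_top ρ _) (by finiteness)).2 h2
    rwa [ENNReal.toReal_mul, ENNReal.toReal_ofReal measureReal_nonneg] at this

/-- **Two punctured-DLR measures with the same mass on `{σ_z = s}` differ on
`{σ_B ≡ +1} ∩ {σ_z = s}` by at most the punctured gap**:
`|ρ₁(E_B ∩ {σ_z = s}) − ρ₂(E_B ∩ {σ_z = s})| ≤ ∑_{i∈B} (μ^{1[z↦s]}_Λ(σ_i = 1) − μ^{(-1)[z↦s]}_Λ(σ_i = 1))`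
(sandwich for both measures, `ρ(σ_z = s) ≤ 1`, and the gap bound
`measureReal_forall_eq_one_sub_le_sum`). (Friedli–Velenik 2017, Thm. 3.28, p. 117, punctured.) [cite: FriedliVelenik2017, Thm. 3.28, p. 117] -/
theorem abs_sub_le_of_punctured_dlr [Countable V] {β : ℝ} (hβ : 0 ≤ β) (h : ℝ) {Λ : Finset V}
    {z : V} (hz : z ∉ Λ) {ρ₁ ρ₂ : Measure (SpinConfig V)} [IsProbabilityMeasure ρ₁]
    [IsProbabilityMeasure ρ₂]
    (hDLR₁ : ∀ A : Set (SpinConfig V), MeasurableSet A →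
      ∫⁻ η, isingMeasure G Λ β h (.fixed η) A ∂ρ₁ = ρ₁ A)
    (hDLR₂ : ∀ A : Set (SpinConfig V), MeasurableSet A →
      ∫⁻ η, isingMeasure G Λ β h (.fixed η) A ∂ρ₂ = ρ₂ A)
    (s : ℤˣ) (hS : ρ₁.real {σ : SpinConfig V | σ z = s} = ρ₂.real {σ : SpinConfig V | σ z = s})
    (B : Finset V) :
    |ρ₁.real ({σ : SpinConfig V | ∀ i ∈ B, σ i = 1} ∩ {σ : SpinConfig V | σ z = s}) -
        ρ₂.real ({σ : SpinConfig V | ∀ i ∈ B, σ i = 1} ∩ {σ : SpinConfig V | σ z = s})| ≤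
      ∑ i ∈ B, ((isingMeasure G Λ β h (.fixed (Function.update 1 z s))).real
          {σ : SpinConfig V | σ i = 1} -
        (isingMeasure G Λ β h (.fixed (Function.update (-1) z s))).real
          {σ : SpinConfig V | σ i = 1}) := by
  obtain ⟨h1l, h1u⟩ := sandwich_of_punctured_dlr G hβ h hz hDLR₁ s B
  obtain ⟨h2l, h2u⟩ := sandwich_of_punctured_dlr G hβ h hz hDLR₂ s B
  rw [hS] at h1l h1u
  have hle : Function.update (-1 : SpinConfig V) z s ≤ Function.update (1 : SpinConfig V) z s :=
    update_neg_one_le (Function.update_self z s (1 : SpinConfig V))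
  have hgap := measureReal_forall_eq_one_sub_le_sum G hβ Λ h hle B
  have hEm : MeasurableSet {σ : SpinConfig V | ∀ i ∈ B, σ i = 1} := measurableSet_forall_eq_one B
  have hgap0 : (isingMeasure G Λ β h (.fixed (Function.update (-1) z s))).real
        {σ : SpinConfig V | ∀ i ∈ B, σ i = 1} ≤
      (isingMeasure G Λ β h (.fixed (Function.update 1 z s))).real
        {σ : SpinConfig V | ∀ i ∈ B, σ i = 1} := by
    rw [← integral_indicator_one hEm, ← integral_indicator_one hEm]
    exact integral_isingMeasure_fixed_mono G hβ Λ h hle (monotone_indicator_forall_eq_one B)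
      (measurable_one.indicator hEm)
  have hp0 : 0 ≤ ρ₂.real {σ : SpinConfig V | σ z = s} := measureReal_nonneg
  have hp1 : ρ₂.real {σ : SpinConfig V | σ z = s} ≤ 1 := measureReal_le_one
  have hprod : ((isingMeasure G Λ β h (.fixed (Function.update 1 z s))).real
        {σ : SpinConfig V | ∀ i ∈ B, σ i = 1} -
      (isingMeasure G Λ β h (.fixed (Function.update (-1) z s))).real
        {σ : SpinConfig V | ∀ i ∈ B, σ i = 1}) * ρ₂.real {σ : SpinConfig V | σ z = s} ≤
      (isingMeasure G Λ β h (.fixed (Function.update 1 z s))).real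
        {σ : SpinConfig V | ∀ i ∈ B, σ i = 1} -
      (isingMeasure G Λ β h (.fixed (Function.update (-1) z s))).real
        {σ : SpinConfig V | ∀ i ∈ B, σ i = 1} :=
    mul_le_of_le_one_right (sub_nonneg.2 hgap0) hp1
  rw [abs_sub_le_iff]
  constructor <;> nlinarith

end Summit.CriticalPhenomena.Ising3DConformalLimit.Theorems.LatticePunctured
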